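import Mathlib
import Literature.AlgebraicGeometry.Hironaka2017.WQUniversal
import Literature.GroupTheory.PermutationGroups.SmallIndexSubgroups

/-!
# `NoHeavyLowerTail` (crux stmt-CriticalPhenomena-4575), lane prim-ineq-gen-4 (gen 24): the Pascal–Gram identity (★)

Support file (`--supports stmt-CriticalPhenomena-4575`; memo
`run/shared/lean/prim/prim-ineq-gen-4/FINDING-SYMMETRIC-TP-g24.md` §2.3, proofs file `PROOFS-SYMMETRIC-TP-g24.md` Lemma 3).
No definitions, no `sorry`, standard axioms.

For the matrix `M[x,x'] = C(n-1-#(x ∪ x'), k)` on the ball of radius `k` in `2^[n]` (the anti-band / parity-inertia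
programme of gens 20–23), the row sums over levels are `Q[a,b] = Σ_{c ≤ k} (-1)^{k-c} C(n-a,c) C(n-c,b)`.  The identity
proved here,

  `Σ_{c ≤ k} (-1)^{k+c} C(n-a,c) C(n-c,b) = Σ_{j < n-k} C(j+k-a,k) C(j,n-k-1-b)`   (for `1 ≤ k`, `a+b+1 ≤ n`, `b+k+1 ≤ n`),

exhibits `Q` as `Λ · (PᵀP) · (column reversal)` with `P` the Pascal matrix, which is the total-positivity mechanism
behind the theorem "(M') holds for every `S_n`-invariant family at every `n ≥ 2k+1`" (memo §2).  The proof is the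
elementary induction on `a` of the proofs file: both sides satisfy `X(n,a,b) = X(n-1,a-1,b-1) + X(n-1,a-1,b)`.
(The hockey stick and the rearrangement `C(n,j)C(n-j,k) = C(n,k)C(n-k,j)` are reused from the Literature tree.)
-/

namespace Summit.CriticalPhenomena.PercolationContinuityZ3.Theorems.AntiBandPascalGram

open Finset

/-- Truncated alternating row sum of Pascal's triangle:
`Σ_{c ≤ k} (-1)^{k+c} C(N,c) = C(N-1,k)` for `1 ≤ N`. [folklore] -/
theorem alternating_partial_sum_choose (N k : ℕ) (hN : 1 ≤ N) :
    ∑ c ∈ range (k + 1), (-1 : ℤ) ^ (k + c) * (N.choose c : ℤ) = ((N - 1).choose k : ℤ) := by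
  induction k with
  | zero => simp
  | succ k ih =>
    rw [Finset.sum_range_succ]
    have hrw : ∑ c ∈ range (k + 1), (-1 : ℤ) ^ (k + 1 + c) * (N.choose c : ℤ)
        = -∑ c ∈ range (k + 1), (-1 : ℤ) ^ (k + c) * (N.choose c : ℤ) := by
      rw [← Finset.sum_neg_distrib]
      refine Finset.sum_congr rfl fun c _ => ?_
      rw [show k + 1 + c = (k + c) + 1 by ring, pow_succ]
      ring
    rw [hrw, ih]
    obtain ⟨N', rfl⟩ : ∃ N', N = N' + 1 := ⟨N - 1, by omega⟩
    simp only [Nat.add_sub_cancel]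
    rw [show k + 1 + (k + 1) = 2 * (k + 1) by ring, pow_mul]
    norm_num
    rw [Nat.choose_succ_succ' N' k]
    push_cast
    ring


/-- The product rearrangement `C(j+k,k) C(j,r) = C(k+r,k) C(j+k,k+r)`. [folklore] -/
theorem choose_add_mul_choose (j k r : ℕ) :
    (j + k).choose k * j.choose r = (k + r).choose k * (j + k).choose (k + r) := by
  rcases le_or_gt r j with h | h
  · -- (j+k).choose j * j.choose r = (j+k).choose r * (j+k-r).choose (j-r)   [choose_mul, s=r ≤ j ≤ j+k]
    have h1 := Nat.choose_mul (n := j + k) (k := j) (s := r) h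
    rw [Nat.choose_symm_add] at h1
    -- (j+k).choose (k+r) * (k+r).choose r = (j+k).choose r * (j+k-r).choose (k+r-r)
    have h2 := Nat.choose_mul (n := j + k) (k := k + r) (s := r) (by omega)
    rw [show k + r - r = k by omega] at h2
    rw [show j + k - r = (j - r) + k by omega] at h1
    rw [show j + k - r = (j - r) + k by omega] at h2
    have h3 : (j - r + k).choose (j - r) = (j - r + k).choose k := Nat.choose_symm_add
    have h4 : (k + r).choose r = (k + r).choose k := by
      rw [add_comm k r]; exact Nat.choose_symm_add
    rw [h3] at h1
    rw [h4] at h2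
    rw [h1, ← h2]
    ring
  · have : j.choose r = 0 := Nat.choose_eq_zero_of_lt h
    have : (j + k).choose (k + r) = 0 := Nat.choose_eq_zero_of_lt (by omega)
    simp [*]

/-- Base case `a = 0` of (★): `Σ_{c≤k} (-1)^{k+c} C(n,c) C(n-c,b) = C(n,b) C(n-b-1,k)` (`b+1 ≤ n`). [gen 24] -/
theorem lhs_zero (n k b : ℕ) (hb : b + 1 ≤ n) :
    ∑ c ∈ range (k + 1), (-1 : ℤ) ^ (k + c) * ((n.choose c : ℤ) * ((n - c).choose b : ℤ))
      = (n.choose b : ℤ) * ((n - b - 1).choose k : ℤ) := by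
  have : ∀ c, (n.choose c : ℤ) * ((n - c).choose b : ℤ) = (n.choose b : ℤ) * ((n - b).choose c : ℤ) := by
    intro c; exact_mod_cast Literature.GroupTheory.PermutationGroups.choose_mul_choose_sub n c b
  simp_rw [this]
  have : ∑ c ∈ range (k + 1), (-1 : ℤ) ^ (k + c) * ((n.choose b : ℤ) * ((n - b).choose c : ℤ))
      = (n.choose b : ℤ) * ∑ c ∈ range (k + 1), (-1 : ℤ) ^ (k + c) * ((n - b).choose c : ℤ) := by
    rw [Finset.mul_sum]; refine Finset.sum_congr rfl fun c _ => by ring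
  rw [this, alternating_partial_sum_choose (n - b) k (by omega)]

/-- Right-hand side at `a = 0`: `Σ_{j<m} C(j+k,k) C(j,m-1-b) = C(m+k,b) C(m+k-b-1,k)` (`b+1 ≤ m`). [gen 24] -/
theorem rhs_zero (m k b : ℕ) (hb : b + 1 ≤ m) :
    ∑ j ∈ range m, ((j + k).choose k : ℤ) * ((j.choose (m - 1 - b)) : ℤ)
      = (((m + k).choose b : ℤ)) * (((m + k - b - 1).choose k : ℤ)) := by
  set r := m - 1 - b with hr
  have h1 : ∀ j, ((j + k).choose k : ℤ) * (j.choose r : ℤ) = ((k + r).choose k : ℤ) * ((j + k).choose (k + r) : ℤ) := by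
    intro j; exact_mod_cast choose_add_mul_choose j k r
  simp_rw [h1, ← Finset.mul_sum]
  -- hockey stick: Σ_{j<m} C(j+k, k+r) = C(m+k, k+r+1)
  have h2 : ∑ j ∈ range m, ((j + k).choose (k + r) : ℤ) = ((m + k).choose (k + r + 1) : ℤ) := by
    have h3 : ∑ i ∈ range (k + m), (i.choose (k + r) : ℤ) = ((k + m).choose (k + r + 1) : ℤ) := by
      exact_mod_cast Literature.AlgebraicGeometry.Hironaka2017.WQUniversal.sum_range_choose_eq (k + m) (k + r)
    rw [Finset.sum_range_add] at h3
    have h4 : ∑ i ∈ range k, (i.choose (k + r) : ℤ) = 0 := by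
      refine Finset.sum_eq_zero fun i hi => ?_
      rw [Finset.mem_range] at hi
      rw [Nat.choose_eq_zero_of_lt (by omega)]; simp
    rw [h4, zero_add] at h3
    rw [show m + k = k + m by ring, ← h3]
    refine Finset.sum_congr rfl fun j _ => by rw [add_comm j k]
  rw [h2]
  -- C(k+r,k) C(m+k, k+r+1) = C(m+k,b) C(m+k-b-1,k):  k+r+1 = m+k-b, and C(k+r,k) with k+r = m+k-b-1
  have e1 : k + r + 1 = (m + k) - b := by omega
  have e2 : k + r = m + k - b - 1 := by omega
  rw [e1, e2, Nat.choose_symm (by omega : b ≤ m + k)]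
  ring

/-- Pascal recursion of the left-hand side of (★) in `(n, a, b)`:
`L(n+1, a+1, b+1) = L(n, a, b) + L(n, a, b+1)` (for `a + 1 ≤ n`). [gen 24] -/
theorem lhs_rec (n k a b : ℕ) (ha : a + 1 ≤ n) :
    ∑ c ∈ range (k + 1), (-1 : ℤ) ^ (k + c) * (((n + 1 - (a + 1)).choose c : ℤ) * ((n + 1 - c).choose (b + 1) : ℤ))
      = ∑ c ∈ range (k + 1), (-1 : ℤ) ^ (k + c) * (((n - a).choose c : ℤ) * ((n - c).choose b : ℤ))
        + ∑ c ∈ range (k + 1), (-1 : ℤ) ^ (k + c) * (((n - a).choose c : ℤ) * ((n - c).choose (b + 1) : ℤ)) := by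
  rw [← Finset.sum_add_distrib]
  refine Finset.sum_congr rfl fun c _ => ?_
  have hpt : (n + 1 - (a + 1)).choose c * (n + 1 - c).choose (b + 1)
      = (n - a).choose c * ((n - c).choose b + (n - c).choose (b + 1)) := by
    rw [Nat.add_sub_add_right]
    by_cases hc : c ≤ n
    · rw [show n + 1 - c = (n - c) + 1 by omega, Nat.choose_succ_succ']
    · rw [Nat.choose_eq_zero_of_lt (by omega : n - a < c)]; simp
  have hz : ((n + 1 - (a + 1)).choose c : ℤ) * ((n + 1 - c).choose (b + 1) : ℤ)
      = ((n - a).choose c : ℤ) * (((n - c).choose b : ℤ) + ((n - c).choose (b + 1) : ℤ)) := by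
    exact_mod_cast hpt
  rw [hz]; ring

/-- Pascal recursion of the right-hand side of (★) (with its natural support condition `b + k + 1 ≤ n`):
`R(n+1, a+1, b+1) = R(n, a, b) + R(n, a, b+1)` (for `1 ≤ k ≤ n`). [gen 24] -/
theorem rhs_rec (n k a b : ℕ) (hk : 1 ≤ k) (hkn : k ≤ n) :
    (if b + 1 + k + 1 ≤ n + 1 then
        ∑ j ∈ range (n + 1 - k), (((j + k - (a + 1)).choose k : ℤ) * ((j.choose (n + 1 - k - 1 - (b + 1))) : ℤ)) else 0)
      = (if b + k + 1 ≤ n then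
          ∑ j ∈ range (n - k), (((j + k - a).choose k : ℤ) * ((j.choose (n - k - 1 - b)) : ℤ)) else 0)
        + (if b + 1 + k + 1 ≤ n then
          ∑ j ∈ range (n - k), (((j + k - a).choose k : ℤ) * ((j.choose (n - k - 1 - (b + 1))) : ℤ)) else 0) := by
  have hg0 : ((0 + k - (a + 1)).choose k : ℤ) = 0 := by
    rw [Nat.choose_eq_zero_of_lt (by omega)]; simp
  by_cases h1 : b + k + 1 ≤ n
  · rw [if_pos (by omega), if_pos h1]
    rw [show n + 1 - k = (n - k) + 1 by omega, Finset.sum_range_succ', hg0, zero_mul, add_zero]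
    by_cases h2 : b + 1 + k + 1 ≤ n
    · rw [if_pos h2, ← Finset.sum_add_distrib]
      refine Finset.sum_congr rfl fun j _ => ?_
      try rw [show j + 1 + k - (a + 1) = j + k - a by omega]
      rw [show n - k + 1 - 1 - (b + 1) = n - k - 1 - b by omega]
      have hp : (j + 1).choose (n - k - 1 - b) = j.choose (n - k - 1 - b) + j.choose (n - k - 1 - (b + 1)) := by
        rw [show n - k - 1 - b = (n - k - 1 - (b + 1)) + 1 by omega, Nat.choose_succ_succ', add_comm]
      rw [hp]; push_cast; ring
    · rw [if_neg h2, add_zero]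
      refine Finset.sum_congr rfl fun j _ => ?_
      try rw [show j + 1 + k - (a + 1) = j + k - a by omega]
      rw [show n - k + 1 - 1 - (b + 1) = 0 by omega, show n - k - 1 - b = 0 by omega]
      simp
  · rw [if_neg (by omega), if_neg h1, if_neg (by omega), add_zero]

/-- (★) with its support condition, in the form used for the induction on `a`. [gen 24] -/
theorem pascalGram_aux (k : ℕ) (hk : 1 ≤ k) :
    ∀ a n b : ℕ, a + b + 1 ≤ n →
      ∑ c ∈ range (k + 1), (-1 : ℤ) ^ (k + c) * (((n - a).choose c : ℤ) * ((n - c).choose b : ℤ))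
        = (if b + k + 1 ≤ n then
            ∑ j ∈ range (n - k), (((j + k - a).choose k : ℤ) * ((j.choose (n - k - 1 - b)) : ℤ)) else 0) := by
  intro a
  induction a with
  | zero =>
    intro n b hab
    rw [Nat.sub_zero, lhs_zero n k b (by omega)]
    by_cases h : b + k + 1 ≤ n
    · rw [if_pos h]
      have hr := rhs_zero (n - k) k b (by omega)
      rw [show n - k + k = n by omega] at hr
      rw [← hr]
      refine Finset.sum_congr rfl fun j _ => ?_
      rw [Nat.sub_zero]
    · rw [if_neg h, Nat.choose_eq_zero_of_lt (by omega : n - b - 1 < k)]; simp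
  | succ a ih =>
    intro n b hab
    cases b with
    | zero =>
      -- b = 0: both sides equal C(n-a-2, k)
      have hL : ∑ c ∈ range (k + 1), (-1 : ℤ) ^ (k + c) * (((n - (a + 1)).choose c : ℤ) * ((n - c).choose 0 : ℤ))
          = ((n - (a + 1) - 1).choose k : ℤ) := by
        rw [← alternating_partial_sum_choose (n - (a + 1)) k (by omega)]
        refine Finset.sum_congr rfl fun c _ => by simp
      rw [hL]
      by_cases h : 0 + k + 1 ≤ n
      · rw [if_pos h]
        obtain ⟨m, hm⟩ : ∃ m, n - k = m + 1 := ⟨n - k - 1, by omega⟩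
        rw [hm, Finset.sum_range_succ]
        simp only [Nat.add_sub_cancel, Nat.sub_zero]
        have hz : ∑ j ∈ range m, ((j + k - (a + 1)).choose k : ℤ) * ((j.choose m) : ℤ) = 0 := by
          refine Finset.sum_eq_zero fun j hj => ?_
          rw [Finset.mem_range] at hj
          rw [Nat.choose_eq_zero_of_lt hj]; simp
        rw [hz, zero_add, Nat.choose_self, show m + k - (a + 1) = n - (a + 1) - 1 by omega]
        simp
      · rw [if_neg h, Nat.choose_eq_zero_of_lt (by omega : n - (a + 1) - 1 < k)]; simp
    | succ b =>
      obtain ⟨n', rfl⟩ : ∃ n', n = n' + 1 := ⟨n - 1, by omega⟩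
      rw [lhs_rec n' k a b (by omega), ih n' b (by omega), ih n' (b + 1) (by omega)]
      by_cases hkn : k ≤ n'
      · rw [rhs_rec n' k a b hk hkn]
      · -- k > n': every support condition fails
        rw [if_neg (by omega), if_neg (by omega), if_neg (by omega), add_zero]

/-- **The Pascal–Gram identity (★)** (memo FINDING-SYMMETRIC-TP-g24.md §2.3, Lemma 3 of PROOFS-SYMMETRIC-TP-g24.md):
for `1 ≤ k`, `a + b + 1 ≤ n` and `b + k + 1 ≤ n`,
`Σ_{c ≤ k} (-1)^{k+c} C(n-a,c) C(n-c,b) = Σ_{j < n-k} C(j+k-a,k) C(j,n-k-1-b)`.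
The left side is the level row sum `Q[a,b]` of `M[x,x'] = C(n-1-#(x∪x'),k)` (Lemma 2 there); the right side exhibits
`Q = Λ·(PᵀP)·W` with `P` the Pascal matrix (for `a ≤ k`, `C(j+k-a,k) = Σ_p C(k-a,k-p)C(j,p)`), the total-positivity
mechanism behind parity inertia of all `S_n`-invariant families. [gen 24] -/
theorem pascalGram (n k a b : ℕ) (hk : 1 ≤ k) (hab : a + b + 1 ≤ n) (hbk : b + k + 1 ≤ n) :
    ∑ c ∈ range (k + 1), (-1 : ℤ) ^ (k + c) * (((n - a).choose c : ℤ) * ((n - c).choose b : ℤ))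
      = ∑ j ∈ range (n - k), (((j + k - a).choose k : ℤ) * ((j.choose (n - k - 1 - b)) : ℤ)) := by
  rw [pascalGram_aux k hk a n b hab, if_pos hbk]

end Summit.CriticalPhenomena.PercolationContinuityZ3.Theorems.AntiBandPascalGram
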